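import Summits.ResolutionOfSingularities.ResolutionOfSingularities.Theorems.NarrowRunsDie.Negative.JacobianQuotientFinite
import Summits.ResolutionOfSingularities.ResolutionOfSingularities.Theorems.NarrowRunsDie.Negative.FuelFamilyRun
import Literature.Computability.AlgebraicComplexity.DeterminantalConormalBoundProofs

/-!
# `NarrowRunsDie` (crux stmt-ResolutionOfSingularities-16882, route `WildCones`): the fuel family
# `a_k = u₀²u₁ + u₁³u₂ + u₀u₂^k` is NARROW and ISOLATED for every `k ≥ 3`
(negative-side support for crux stmt-ResolutionOfSingularities-16882, refuter crux-disprover seat; this file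
does NOT refute the crux)

With the crux calculus as constrained variables (VERBATIM bodies at `p = n = 3`, `κ = 𝔽₃`):
`cone (a_k) = X₀²X₁` (`cone_cf`), `Linv (a_k) = {w | w₀ = w₁ = 0}` (`linv_cf`: evaluate the
defining identity at `(X₀,X₁,S) = (0,1,1)` and `(1,0,1)`), `dL (a_k) = 1` (`dL_cf`); the Jacobian
generators are `∂₀ = 2X₀X₁ + X₂^k`, `∂₁ = X₀²` (the `u₁³u₂` term dies, `3 = 0`),
`∂₂ = X₁³ + k X₀X₂^(k-1)` (`pd_zero_cf`, `pd_one_cf`, `pd_two_cf`), so the Jacobian ideal contains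
`X₀²`, `X₁⁶ = ∂₂(X₁³ − M) + M²` and `X₂^(2k) = ∂₀(X₂^k − N) + N²` (`M = kX₀X₂^(k-1)`, `N = 2X₀X₁`,
both squares multiples of `X₀²`), and `isol_cf` follows from `moduleFinite_quotient_of_X_pow_mem`
(Milnor-type number `6k`; python cross-check `exp/dyn.py`: `54, 42, 30, 18, 6` along the run).
-/

noncomputable section

set_option linter.dupNamespace false

namespace Summit.ResolutionOfSingularities.ResolutionOfSingularities.Theorems.NarrowRunsDie.Negative.Family

open MvPowerSeries
open Literature.Computability.AlgebraicComplexity.DeterminantalConormal (finsupp_fin_three_eq_iff)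

variable (clean : ((Fin 3 → ℕ) → ZMod 3) → ((Fin 3 → ℕ) → ZMod 3))
  (hclean : clean = fun c A => @ite (ZMod 3) (∀ j, 3 ∣ A j) (Classical.dec _) 0 (c A))
variable (ser : ((Fin 3 → ℕ) → ZMod 3) → MvPowerSeries (Fin 3) (ZMod 3))
  (hser : ser = fun c => show MvPowerSeries (Fin 3) (ZMod 3) from fun A : Fin 3 →₀ ℕ => clean c ⇑A)
variable (pd : Fin 3 → MvPowerSeries (Fin 3) (ZMod 3) → MvPowerSeries (Fin 3) (ZMod 3))
  (hpd : pd = fun i f => show MvPowerSeries (Fin 3) (ZMod 3) from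
    fun A : Fin 3 →₀ ℕ => ((A i + 1 : ℕ) : ZMod 3) * f (A + Finsupp.single i 1))
variable (jac : ((Fin 3 → ℕ) → ZMod 3) → Ideal (MvPowerSeries (Fin 3) (ZMod 3)))
  (hjac : jac = fun c => Ideal.span (Set.range (fun i => pd i (ser c))))
variable (cone : ((Fin 3 → ℕ) → ZMod 3) → MvPolynomial (Fin 3) (ZMod 3))
  (hcone : cone = fun c => Finset.sum (Fintype.piFinset (fun _ : Fin 3 => Finset.range (3 + 1)))
    (fun A => @ite (MvPolynomial (Fin 3) (ZMod 3)) (Finset.sum Finset.univ (fun j => A j) = 3) (Classical.dec _)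
      (MvPolynomial.monomial (Finsupp.equivFunOnFinite.symm A) (clean c A)) 0))
variable (Linv : ((Fin 3 → ℕ) → ZMod 3) → Set (Fin 3 → ZMod 3))
  (hLinv : Linv = fun c => {w : Fin 3 → ZMod 3 | MvPolynomial.aeval (fun j : Fin 3 =>
    (MvPolynomial.X (some j) : MvPolynomial (Option (Fin 3)) (ZMod 3)) +
      MvPolynomial.C (w j) * MvPolynomial.X none)
      (cone c) = MvPolynomial.rename some (cone c) +
        MvPolynomial.C (MvPolynomial.eval w (cone c)) * (MvPolynomial.X none) ^ 3})
variable (dL : ((Fin 3 → ℕ) → ZMod 3) → ℕ)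
  (hdL : dL = fun c => Module.finrank (ZMod 3) (Submodule.span (ZMod 3) (Linv c)))

/-! ### The family `a_k = u₀²u₁ + u₁³u₂ + u₀u₂^k` (exponents `![2,1,0]`, `![0,3,1]`, `![1,0,k]`,
all coefficients `1`), as a constrained variable `cf` -/

variable (cf : ℕ → (Fin 3 → ℕ) → ZMod 3)
  (hcf : cf = fun k => (Pi.single (![2, 1, 0] : Fin 3 → ℕ) (1 : ZMod 3) : (Fin 3 → ℕ) → ZMod 3) +
    Pi.single (![0, 3, 1] : Fin 3 → ℕ) (1 : ZMod 3) + Pi.single (![1, 0, k] : Fin 3 → ℕ) (1 : ZMod 3))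

/-- `![2,1,0]` is in the exponent box of the cone sum. -/
theorem v1_mem : (![2, 1, 0] : Fin 3 → ℕ) ∈ Fintype.piFinset (fun _ : Fin 3 => Finset.range (3 + 1)) := by
  rw [Fintype.mem_piFinset]; intro j; fin_cases j <;> simp

include hclean hcone hcf in
/-- The cone of `a_k` (`k ≥ 3`) is the single monomial `u₀²u₁`. -/
theorem cone_cf (k : ℕ) (hk : 3 ≤ k) :
    cone (cf k) = MvPolynomial.monomial (Finsupp.equivFunOnFinite.symm ![2, 1, 0]) 1 := by
  rw [hcone]
  beta_reduce
  rw [clean_cf clean hclean cf hcf, Finset.sum_eq_single (![2, 1, 0] : Fin 3 → ℕ)]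
  · rw [if_pos sum_v1, cf_eq_one_of cf hcf k _ (Or.inl rfl)]
  · intro b _ hb
    by_cases hs : Finset.sum Finset.univ (fun j => b j) = 3
    · rw [if_pos hs]
      have hb0 : cf k b = 0 := by
        by_contra hne
        rcases (cf_ne_zero_iff cf hcf k b).1 hne with rfl | rfl | rfl
        · exact hb rfl
        · rw [sum_v2] at hs; omega
        · rw [sum_v3] at hs; omega
      rw [hb0, MvPolynomial.monomial_zero]
    · rw [if_neg hs]
  · intro h; exact absurd v1_mem h

/-- … i.e. `X 0 ^ 2 * X 1`. -/
theorem monomial_v1 : MvPolynomial.monomial (Finsupp.equivFunOnFinite.symm ![2, 1, 0]) (1 : ZMod 3)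
    = (MvPolynomial.X 0 : MvPolynomial (Fin 3) (ZMod 3)) ^ 2 * MvPolynomial.X 1 := by
  rw [MvPolynomial.monomial_eq, Finsupp.prod_fintype _ _ (fun i => pow_zero _)]
  simp [Fin.prod_univ_three]

include hclean hcone hLinv hcf in
/-- The cone-invariance set of `a_k` (`k ≥ 3`) is the line `{w | w 0 = 0 ∧ w 1 = 0}` (⊆: evaluate
the defining identity at `(X₀, X₁, S) = (0, 1, 1)` and `(1, 0, 1)`; ⊇: direct). -/
theorem linv_cf (k : ℕ) (hk : 3 ≤ k) : Linv (cf k) = {w | w 0 = 0 ∧ w 1 = 0} := by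
  rw [hLinv]
  ext w
  simp only [Set.mem_setOf_eq, cone_cf clean hclean cone hcone cf hcf k hk, monomial_v1, map_mul,
    map_pow, MvPolynomial.aeval_X, MvPolynomial.rename_X, MvPolynomial.eval_X]
  constructor
  · intro h
    have e1 := congr_arg (MvPolynomial.eval (fun o : Option (Fin 3) => o.elim (1 : ZMod 3) ![0, 1, 0])) h
    have e2 := congr_arg (MvPolynomial.eval (fun o : Option (Fin 3) => o.elim (1 : ZMod 3) ![1, 0, 0])) h
    simp only [map_add, map_mul, map_pow, MvPolynomial.eval_X, MvPolynomial.eval_C, Option.elim_none,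
      Option.elim_some, Matrix.cons_val_zero, Matrix.cons_val_one] at e1 e2
    have hw0 : w 0 ^ 2 = 0 := by linear_combination e1
    have hw0' : w 0 = 0 := (pow_eq_zero_iff (n := 2) (by norm_num)).mp hw0
    have hw1 : w 1 = 0 := by linear_combination e2 - 2 * w 1 * hw0'
    exact ⟨hw0', hw1⟩
  · rintro ⟨h0, h1⟩
    simp [h0, h1]

include hclean hcone hLinv hcf in
/-- Its span is the line `𝔽₃ ∙ e₂`. -/
theorem span_linv_cf (k : ℕ) (hk : 3 ≤ k) :
    Submodule.span (ZMod 3) (Linv (cf k)) = (ZMod 3) ∙ (Pi.single 2 1 : Fin 3 → ZMod 3) := by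
  rw [linv_cf clean hclean cone hcone Linv hLinv cf hcf k hk]
  apply le_antisymm
  · rw [Submodule.span_le]
    rintro w ⟨h0, h1⟩
    have hw : w = w 2 • (Pi.single 2 1 : Fin 3 → ZMod 3) := by
      funext j; fin_cases j <;> simp [h0, h1]
    rw [hw]
    exact Submodule.smul_mem _ _ (Submodule.subset_span rfl)
  · rw [Submodule.span_le]
    rintro w hw
    rw [Set.mem_singleton_iff] at hw
    subst hw
    exact Submodule.subset_span (by simp)

include hclean hcone hLinv hdL hcf in
/-- So `dL = 1` at `a_k` (`k ≥ 3`). -/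
theorem dL_cf (k : ℕ) (hk : 3 ≤ k) : dL (cf k) = 1 := by
  rw [hdL]
  beta_reduce
  rw [span_linv_cf clean hclean cone hcone Linv hLinv cf hcf k hk]
  exact finrank_span_singleton (by simp)

/-! ### Isolatedness of the family states: the Jacobian ideal contains `X₀²`, `X₁⁶`, `X₂^{2k}` -/

/-- Coordinates of `A + single i 1`. -/
theorem coe_add_single (A : Fin 3 →₀ ℕ) (i j : Fin 3) :
    (A + Finsupp.single i 1 : Fin 3 →₀ ℕ) j = A j + if i = j then 1 else 0 := by
  simp [Finsupp.single_apply]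

include hclean hser hpd hcf in
/-- `∂₁ a_k = X₀²` (the `u₁³u₂` term dies: `3 = 0`). -/
theorem pd_one_cf (k : ℕ) : pd 1 (ser (cf k)) = MvPowerSeries.X 0 ^ 2 := by
  rw [hpd, hser]
  ext A
  show ((A 1 + 1 : ℕ) : ZMod 3) * clean (cf k) ⇑(A + Finsupp.single 1 1 : Fin 3 →₀ ℕ) =
    MvPowerSeries.coeff A (MvPowerSeries.X 0 ^ 2)
  rw [clean_cf clean hclean cf hcf, MvPowerSeries.coeff_X_pow, cf_apply cf hcf]
  simp only [funext3_iff, coe_add_single, finsupp_fin_three_eq_iff, Finsupp.single_apply]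
  simp only [Fin.isValue, Matrix.cons_val_zero, Matrix.cons_val_one, Matrix.head_cons, Matrix.cons_val_two,
    Matrix.tail_cons, show ((1 : Fin 3) = 0) = False from by decide, show ((1 : Fin 3) = 2) = False from by decide,
    show ((0 : Fin 3) = 1) = False from by decide, show ((0 : Fin 3) = 2) = False from by decide,
    ↓reduceIte, add_zero]
  by_cases h2 : A 0 = 0 ∧ A 1 + 1 = 3 ∧ A 2 = 1
  · have : ((A 1 + 1 : ℕ) : ZMod 3) = 0 := by rw [h2.2.1]; decide
    rw [this, zero_mul, if_neg (show ¬(A 0 = 2 ∧ A 1 = 0 ∧ A 2 = 0) from by omega)]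
  · rw [if_neg h2, if_neg (show ¬(A 0 = 1 ∧ A 1 + 1 = 0 ∧ A 2 = k) from by omega)]
    by_cases h1 : A 0 = 2 ∧ A 1 + 1 = 1 ∧ A 2 = 0
    · rw [if_pos h1, if_pos (show A 0 = 2 ∧ A 1 = 0 ∧ A 2 = 0 from by omega),
        show A 1 + 1 = 1 from h1.2.1]
      simp
    · rw [if_neg h1, if_neg (show ¬(A 0 = 2 ∧ A 1 = 0 ∧ A 2 = 0) from by omega)]
      simp

include hclean hser hpd hcf in
/-- `∂₀ a_k = 2 X₀X₁ + X₂^k`. -/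
theorem pd_zero_cf (k : ℕ) : pd 0 (ser (cf k)) =
    MvPowerSeries.monomial (Finsupp.single 0 1 + Finsupp.single 1 1) (2 : ZMod 3) + MvPowerSeries.X 2 ^ k := by
  rw [hpd, hser]
  ext A
  show ((A 0 + 1 : ℕ) : ZMod 3) * clean (cf k) ⇑(A + Finsupp.single 0 1 : Fin 3 →₀ ℕ) =
    MvPowerSeries.coeff A (MvPowerSeries.monomial (Finsupp.single 0 1 + Finsupp.single 1 1) (2 : ZMod 3) +
      MvPowerSeries.X 2 ^ k)
  rw [clean_cf clean hclean cf hcf, map_add, MvPowerSeries.coeff_X_pow, MvPowerSeries.coeff_monomial,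
    cf_apply cf hcf]
  simp only [funext3_iff, finsupp_fin_three_eq_iff, Finsupp.single_apply, Finsupp.add_apply]
  simp only [Fin.isValue, Matrix.cons_val_zero, Matrix.cons_val_one, Matrix.head_cons, Matrix.cons_val_two,
    Matrix.tail_cons, show ((1 : Fin 3) = 0) = False from by decide, show ((1 : Fin 3) = 2) = False from by decide,
    show ((0 : Fin 3) = 1) = False from by decide, show ((0 : Fin 3) = 2) = False from by decide,
    show ((2 : Fin 3) = 0) = False from by decide, show ((2 : Fin 3) = 1) = False from by decide,
    ↓reduceIte, add_zero, zero_add]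
  rw [if_neg (show ¬(A 0 + 1 = 0 ∧ A 1 = 3 ∧ A 2 = 1) from by omega)]
  by_cases h1 : A 0 + 1 = 2 ∧ A 1 = 1 ∧ A 2 = 0
  · rw [if_pos h1, if_neg (show ¬(A 0 + 1 = 1 ∧ A 1 = 0 ∧ A 2 = k) from by omega),
      if_pos (show A 0 = 1 ∧ A 1 = 1 ∧ A 2 = 0 from by omega),
      if_neg (show ¬(A 0 = 0 ∧ A 1 = 0 ∧ A 2 = k) from by omega), show A 0 + 1 = 2 from h1.1]
    norm_num
  · rw [if_neg h1, if_neg (show ¬(A 0 = 1 ∧ A 1 = 1 ∧ A 2 = 0) from by omega)]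
    by_cases h3 : A 0 + 1 = 1 ∧ A 1 = 0 ∧ A 2 = k
    · rw [if_pos h3, if_pos (show A 0 = 0 ∧ A 1 = 0 ∧ A 2 = k from by omega), show A 0 + 1 = 1 from h3.1]
      norm_num
    · rw [if_neg h3, if_neg (show ¬(A 0 = 0 ∧ A 1 = 0 ∧ A 2 = k) from by omega)]
      simp

include hclean hser hpd hcf in
/-- `∂₂ a_k = X₁³ + k X₀ X₂^{k-1}` (`k ≥ 1`). -/
theorem pd_two_cf (k : ℕ) (hk : 1 ≤ k) : pd 2 (ser (cf k)) =
    MvPowerSeries.X 1 ^ 3 +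
      MvPowerSeries.monomial (Finsupp.single 0 1 + Finsupp.single 2 (k - 1)) ((k : ℕ) : ZMod 3) := by
  rw [hpd, hser]
  ext A
  show ((A 2 + 1 : ℕ) : ZMod 3) * clean (cf k) ⇑(A + Finsupp.single 2 1 : Fin 3 →₀ ℕ) =
    MvPowerSeries.coeff A (MvPowerSeries.X 1 ^ 3 +
      MvPowerSeries.monomial (Finsupp.single 0 1 + Finsupp.single 2 (k - 1)) ((k : ℕ) : ZMod 3))
  rw [clean_cf clean hclean cf hcf, map_add, MvPowerSeries.coeff_X_pow, MvPowerSeries.coeff_monomial,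
    cf_apply cf hcf]
  simp only [funext3_iff, finsupp_fin_three_eq_iff, Finsupp.single_apply, Finsupp.add_apply]
  simp only [Fin.isValue, Matrix.cons_val_zero, Matrix.cons_val_one, Matrix.head_cons, Matrix.cons_val_two,
    Matrix.tail_cons, show ((1 : Fin 3) = 0) = False from by decide, show ((1 : Fin 3) = 2) = False from by decide,
    show ((0 : Fin 3) = 1) = False from by decide, show ((0 : Fin 3) = 2) = False from by decide,
    show ((2 : Fin 3) = 0) = False from by decide, show ((2 : Fin 3) = 1) = False from by decide,
    ↓reduceIte, add_zero, zero_add]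
  rw [if_neg (show ¬(A 0 = 2 ∧ A 1 = 1 ∧ A 2 + 1 = 0) from by omega)]
  by_cases h2 : A 0 = 0 ∧ A 1 = 3 ∧ A 2 + 1 = 1
  · rw [if_pos h2, if_neg (show ¬(A 0 = 1 ∧ A 1 = 0 ∧ A 2 + 1 = k) from by omega),
      if_pos (show A 0 = 0 ∧ A 1 = 3 ∧ A 2 = 0 from by omega),
      if_neg (show ¬(A 0 = 1 ∧ A 1 = 0 ∧ A 2 = k - 1) from by omega), show A 2 + 1 = 1 from h2.2.2]
    norm_num
  · rw [if_neg h2, if_neg (show ¬(A 0 = 0 ∧ A 1 = 3 ∧ A 2 = 0) from by omega)]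
    by_cases h3 : A 0 = 1 ∧ A 1 = 0 ∧ A 2 + 1 = k
    · rw [if_pos h3, if_pos (show A 0 = 1 ∧ A 1 = 0 ∧ A 2 = k - 1 from by omega), show A 2 + 1 = k from h3.2.2]
      simp
    · rw [if_neg h3, if_neg (show ¬(A 0 = 1 ∧ A 1 = 0 ∧ A 2 = k - 1) from by omega)]
      simp

include hclean hser hpd hjac hcf in
/-- **`a_k` is isolated** (`k ≥ 1`): its Jacobian ideal contains `X₀²`, `X₁⁶` and `X₂^{2k}`, so the
Jacobian quotient is a finite `𝔽₃`-module (`moduleFinite_quotient_of_X_pow_mem`). -/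
theorem isol_cf (k : ℕ) (hk : 1 ≤ k) :
    Module.Finite (ZMod 3) (MvPowerSeries (Fin 3) (ZMod 3) ⧸ jac (cf k)) := by
  have hg : ∀ i, pd i (ser (cf k)) ∈ jac (cf k) := fun i => by
    rw [hjac]; exact Ideal.subset_span ⟨i, rfl⟩
  have g0 := hg 0
  have g1 := hg 1
  have g2 := hg 2
  rw [pd_zero_cf clean hclean ser hser pd hpd cf hcf] at g0
  rw [pd_one_cf clean hclean ser hser pd hpd cf hcf] at g1
  rw [pd_two_cf clean hclean ser hser pd hpd cf hcf k hk] at g2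
  set J := jac (cf k) with hJ
  set N : MvPowerSeries (Fin 3) (ZMod 3) :=
    MvPowerSeries.monomial (Finsupp.single 0 1 + Finsupp.single 1 1) (2 : ZMod 3) with hN
  set M : MvPowerSeries (Fin 3) (ZMod 3) :=
    MvPowerSeries.monomial (Finsupp.single 0 1 + Finsupp.single 2 (k - 1)) ((k : ℕ) : ZMod 3) with hM
  have hNN : N * N ∈ J := by
    have hexp : (Finsupp.single 0 1 + Finsupp.single 1 1 : Fin 3 →₀ ℕ) + (Finsupp.single 0 1 + Finsupp.single 1 1) =
        Finsupp.single 1 2 + Finsupp.single 0 2 := by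
      ext j; fin_cases j <;> simp
    have : N * N = MvPowerSeries.monomial (Finsupp.single 1 2) (4 : ZMod 3) * MvPowerSeries.X 0 ^ 2 := by
      rw [hN, MvPowerSeries.X_pow_eq, MvPowerSeries.monomial_mul_monomial, MvPowerSeries.monomial_mul_monomial,
        hexp]
      norm_num
    rw [this]
    exact J.mul_mem_left _ g1
  have hMM : M * M ∈ J := by
    have hexp : (Finsupp.single 0 1 + Finsupp.single 2 (k - 1) : Fin 3 →₀ ℕ) +
        (Finsupp.single 0 1 + Finsupp.single 2 (k - 1)) = Finsupp.single 2 (2 * (k - 1)) + Finsupp.single 0 2 := by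
      ext j; fin_cases j
      · simp
      · simp
      · simp; omega
    have : M * M = MvPowerSeries.monomial (Finsupp.single 2 (2 * (k - 1))) (((k : ℕ) : ZMod 3) ^ 2) *
        MvPowerSeries.X 0 ^ 2 := by
      rw [hM, MvPowerSeries.X_pow_eq, MvPowerSeries.monomial_mul_monomial, MvPowerSeries.monomial_mul_monomial,
        hexp, sq, mul_one]
    rw [this]
    exact J.mul_mem_left _ g1
  have hX2 : MvPowerSeries.X 2 ^ (k + k) ∈ J := by
    have : (MvPowerSeries.X 2 : MvPowerSeries (Fin 3) (ZMod 3)) ^ (k + k) =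
        (N + MvPowerSeries.X 2 ^ k) * (MvPowerSeries.X 2 ^ k - N) + N * N := by ring
    rw [this]
    exact J.add_mem (J.mul_mem_right _ g0) hNN
  have hX1 : MvPowerSeries.X 1 ^ (5 + 1) ∈ J := by
    have : (MvPowerSeries.X 1 : MvPowerSeries (Fin 3) (ZMod 3)) ^ (5 + 1) =
        (MvPowerSeries.X 1 ^ 3 + M) * (MvPowerSeries.X 1 ^ 3 - M) + M * M := by ring
    rw [this]
    exact J.add_mem (J.mul_mem_right _ g2) hMM
  have hk2 : k + k = (k + k - 1) + 1 := by omega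
  rw [hk2] at hX2
  exact moduleFinite_quotient_of_X_pow_mem J 1 5 (k + k - 1) g1 hX1 hX2

end Summit.ResolutionOfSingularities.ResolutionOfSingularities.Theorems.NarrowRunsDie.Negative.Family

end
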